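import Mathlib
import HarnessLib

/-!
# The coset-kernel module `C(G; H ≤ H′) = ker(R[G/H] → R[G/H′])` and `H`- versus `H′`-invariant characters:
# `Hom_G(A, C) = 0 ⟺ every H-invariant character of A is H′-invariant` (finite group algebra; no named fact)

Topic `RepresentationTheory/FiniteGroups` (namespace = path).  Two definitions with bodies (`cosetKernel`, its
left-regular `DistribMulAction`) and theorems, all proved (no named fact, no `sorry`); written by the prover seat
`bsd-potss-k8t-c4` g25 (cell `bsd-potss`; `--supports` stmt-BirchSwinnertonDyer-19982; closes nothing; nothing about
elliptic curves or number fields is used or claimed here).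

## The mathematics

Let `G` be a group, `H ≤ H′ ≤ G` subgroups with `H′` finite, `R` an additive commutative group on which `#H′` is
invertible (hypothesis `hu : u • (#H′ • r) = r`; e.g. `R = ℤ/p`, `p ∤ #H′`).  The **coset kernel**
`C = cosetKernel H H′ R := {f : G → R | f(gh) = f(g) (h ∈ H), Σ_{h′ ∈ H′} f(gh′) = 0}` is the kernel of the fibre-sum
map `R[G/H] → R[G/H′]` written on right-`H`-invariant functions on `G`; `G` acts by `(σ • f)(g) = f(σ⁻¹ g)`.
For an additive commutative group `A` with a `G`-action `ρ : G → End(A)`, a character `ν : A → R` (additive) is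
`S`-INVARIANT if `ν(ρ(s) a) = ν(a)` for `s ∈ S`, and `μ : A → C` is EQUIVARIANT if `μ(ρ(σ) a) = σ • μ(a)`.

* `eq_zero_of_forall_smul_eq` — **`C^G = 0`**: a `G`-fixed `f ∈ C` is constant, and the fibre sum gives `#H′ • f(1) = 0`.
* `equivariantHom_eq_zero_of_forall_invariant` — **if every `H`-invariant character of `A` is `H′`-invariant then
  `Hom_G(A, C) = 0`**: for equivariant `μ`, `ν = ev₁ ∘ μ` is `H`-invariant (right `H`-invariance of `μ(a)`), hence
  `H′`-invariant, and `μ(a)(g) = ν(ρ(g)⁻¹ a)` has fibre sums `#H′ • ν(ρ(g)⁻¹ a) = 0`, so `μ = 0`.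
* `invariant_of_forall_equivariantHom_eq_zero` — **if `Hom_G(A, C) = 0` then every `H`-invariant character `ν` is
  `H′`-invariant**: with the `H′`-average `ν′ = u • Σ_{h′} ν ∘ ρ(h′)⁻¹` (which is `H′`-invariant), the map
  `μ_ν(a)(g) = ν(ρ(g)⁻¹ a) − ν′(ρ(g)⁻¹ a)` is an equivariant `A → C`; `μ_ν = 0` forces `ν = ν′`.

So, layer by layer along a tower of `G`-modules `A_n` for which «`Hom_G(A_0, V) = 0 ⟹ Hom_G(A_n, V) = 0`» holds for
every `p`-torsion `G`-module `V` with `V^G = 0` (the tree's EQUIVARIANT IWASAWA LEMMA for the class groups of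
`L·ℚ_n`, `L/ℚ` Galois with one prime above `p`: `NumberFields/EquivariantIwasawaLemmaTotallyRamified.lean`), the
property «every `H`-invariant `𝔽_p`-character of `A_n` is `H′`-invariant» — i.e. `rank_p Cl((L^H)_n) = rank_p Cl((L^{H′})_n)`
through `NumberFields/ClassGroupFixedHomDescent.lean` — propagates from `n = 0` to all `n`.  This file is the
group-algebra brick of that «rank-equality transfer» door of the cell's μ-road census (K8-t′ / K9); the arithmetic
assembly is NOT done here.

## References

Standard finite group representation theory (Frobenius reciprocity for the permutation module `R[G/H] = Ind_H^G R`;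
Maschke splitting of `R[G/H] ↠ R[G/H′]` when `#H′` is invertible): J.-P. Serre, *Linear Representations of Finite Groups*,
GTM 42, §3.3 (Example 2: the permutation representation on `G/H`) and §7.2 Thm. 13 (Frobenius reciprocity); the statements
below are these facts written out for the kernel of `R[G/H] ↠ R[G/H′]`, in the form the cell's door consumes.
[SerreLinearRepresentations1977]
-/

noncomputable section

open scoped BigOperators

namespace Literature.RepresentationTheory.FiniteGroups

variable {G : Type*} [Group G] (H H' : Subgroup G) (R : Type*) [AddCommGroup R]

/-- **The coset kernel `C(G; H ≤ H′)`**: right-`H`-invariant functions `f : G → R` whose sums over every left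
`H′`-coset vanish, `Σ_{h′ ∈ H′} f(g h′) = 0` — the kernel of the fibre-sum map `R[G/H] → R[G/H′]` of permutation modules,
written on functions on `G`. [cite: SerreLinearRepresentations1977, §3.3 Example 2 (the permutation representation of G on G/H)] -/
def cosetKernel [Fintype H'] : AddSubgroup (G → R) where
  carrier := {f | (∀ g : G, ∀ h ∈ H, f (g * h) = f g) ∧ ∀ g : G, ∑ h' : H', f (g * (h' : G)) = 0}
  zero_mem' := ⟨fun _ _ _ => rfl, fun _ => by simp⟩
  add_mem' := by
    rintro f f' ⟨hf1, hf2⟩ ⟨hf1', hf2'⟩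
    refine ⟨fun g h hh => by simp only [Pi.add_apply, hf1 g h hh, hf1' g h hh], fun g => ?_⟩
    simp only [Pi.add_apply, Finset.sum_add_distrib, hf2 g, hf2' g, add_zero]
  neg_mem' := by
    rintro f ⟨hf1, hf2⟩
    refine ⟨fun g h hh => by simp only [Pi.neg_apply, hf1 g h hh], fun g => ?_⟩
    simp only [Pi.neg_apply, Finset.sum_neg_distrib, hf2 g, neg_zero]

variable [Fintype H']

/-- Membership in the coset kernel. [cite: SerreLinearRepresentations1977, §3.3 Example 2 (the permutation representation of G on G/H)] -/
theorem mem_cosetKernel_iff (f : G → R) :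
    f ∈ cosetKernel H H' R ↔ (∀ g : G, ∀ h ∈ H, f (g * h) = f g) ∧ ∀ g : G, ∑ h' : H', f (g * (h' : G)) = 0 :=
  Iff.rfl

/-- **The left-regular action of `G` on the coset kernel**, `(σ • f)(g) = f(σ⁻¹ g)` (it preserves right
`H`-invariance and the coset sums). [cite: SerreLinearRepresentations1977, §3.3 Example 2 (the permutation representation of G on G/H)] -/
instance cosetKernelAction : DistribMulAction G (cosetKernel H H' R) where
  smul σ f := ⟨fun x => f.1 (σ⁻¹ * x),
    fun x h hh => by simpa only [mul_assoc] using f.2.1 (σ⁻¹ * x) h hh,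
    fun x => by simpa only [mul_assoc] using f.2.2 (σ⁻¹ * x)⟩
  one_smul f := by ext x; change f.1 (1⁻¹ * x) = f.1 x; rw [inv_one, one_mul]
  mul_smul σ τ f := by ext x; change f.1 ((σ * τ)⁻¹ * x) = f.1 (τ⁻¹ * (σ⁻¹ * x)); rw [mul_inv_rev, mul_assoc]
  smul_zero σ := by ext; rfl
  smul_add σ f f' := by ext; rfl

/-- `(σ • f)(x) = f(σ⁻¹ x)`. [cite: SerreLinearRepresentations1977, §3.3 Example 2 (the permutation representation of G on G/H)] -/
@[simp] theorem coe_smul_apply (σ : G) (f : cosetKernel H H' R) (x : G) :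
    (σ • f).1 x = f.1 (σ⁻¹ * x) := rfl

/-- **`C^G = 0` when `#H′` is injective on `R`**: a `G`-fixed `f ∈ C(G; H ≤ H′)` is constant (`f(x) = f(1)`), and the
coset sum at `g = 1` reads `#H′ • f(1) = 0` (the trivial character occurs once in `R[G/H]` and once in `R[G/H′]`,
Frobenius reciprocity). [cite: SerreLinearRepresentations1977, §7.2 Thm. 13 (Frobenius reciprocity)] -/
theorem eq_zero_of_forall_smul_eq (hH' : ∀ r : R, Fintype.card H' • r = 0 → r = 0) (f : cosetKernel H H' R)
    (hf : ∀ σ : G, σ • f = f) : f = 0 := by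
  have hconst : ∀ x : G, f.1 x = f.1 1 := fun x => by
    have h := congrArg (fun φ : cosetKernel H H' R => φ.1 x) (hf x)
    simp only [coe_smul_apply, inv_mul_cancel] at h
    exact h.symm
  have hsum := f.2.2 1
  simp only [one_mul, hconst, Finset.sum_const, Finset.card_univ] at hsum
  have h1 : f.1 1 = 0 := hH' _ hsum
  ext x
  rw [hconst x, h1]
  rfl

section Characters

variable {A : Type*} [AddCommGroup A]

/-- `ρ(g g′) a = ρ(g) (ρ(g′) a)`. [folklore] -/
private theorem rho_mul_apply (ρ : G →* AddMonoid.End A) (g g' : G) (a : A) : ρ (g * g') a = ρ g (ρ g' a) := by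
  rw [map_mul]; rfl

/-- `ρ(1) a = a`. [folklore] -/
private theorem rho_one_apply (ρ : G →* AddMonoid.End A) (a : A) : ρ 1 a = a := by
  rw [map_one]; rfl

/-- **If every `H`-invariant character `A → R` is `H′`-invariant, then every `G`-equivariant additive `μ : A → C(G; H ≤ H′)`
vanishes** (`#H′` injective on `R`): `ν = ev₁ ∘ μ` is `H`-invariant (right `H`-invariance of `μ(a)`), hence `H′`-invariant;
`μ(a)(g) = ν(ρ(g)⁻¹ a)`, so the coset sum at `g` is `#H′ • ν(ρ(g)⁻¹ a) = 0` (Frobenius reciprocity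
`Hom_G(A, Ind_H^G R) = Hom_H(A, R)` made explicit on the kernel of `Ind_H^G R ↠ Ind_{H′}^G R`).
[cite: SerreLinearRepresentations1977, §7.2 Thm. 13 (Frobenius reciprocity)] -/
theorem equivariantHom_eq_zero_of_forall_invariant (ρ : G →* AddMonoid.End A)
    (hH' : ∀ r : R, Fintype.card H' • r = 0 → r = 0)
    (hfix : ∀ ν : A →+ R, (∀ h ∈ H, ∀ a : A, ν (ρ h a) = ν a) → ∀ h' ∈ H', ∀ a : A, ν (ρ h' a) = ν a)
    (μ : A →+ cosetKernel H H' R) (hμ : ∀ (σ : G) (a : A), μ (ρ σ a) = σ • μ a) : μ = 0 := by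
  -- `ν = ev₁ ∘ μ`
  let ν : A →+ R :=
    { toFun := fun a => (μ a).1 1
      map_zero' := by rw [map_zero]; rfl
      map_add' := fun a b => by rw [map_add]; rfl }
  have hνapp : ∀ a : A, ν a = (μ a).1 1 := fun a => rfl
  -- `μ(a)(g) = ν(ρ g⁻¹ a)`
  have hμν : ∀ (a : A) (g : G), (μ a).1 g = ν (ρ g⁻¹ a) := fun a g => by
    rw [hνapp, hμ, coe_smul_apply, inv_inv, mul_one]
  -- `ν` is `H`-invariant, hence `H′`-invariant
  have hνH : ∀ h ∈ H, ∀ a : A, ν (ρ h a) = ν a := fun h hh a => by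
    rw [hνapp, hνapp, hμ, coe_smul_apply, mul_one]
    have h1 := (μ a).2.1 1 h⁻¹ (H.inv_mem hh)
    rw [one_mul] at h1
    exact h1
  have hνH' := hfix ν hνH
  -- coset sums: `#H′ • ν(ρ g⁻¹ a) = 0`
  refine AddMonoidHom.ext fun a => Subtype.ext (funext fun g => ?_)
  have hsum := (μ a).2.2 g
  have hterm : ∀ h' : H', (μ a).1 (g * (h' : G)) = ν (ρ g⁻¹ a) := fun h' => by
    rw [hμν, mul_inv_rev, rho_mul_apply, hνH' _ (H'.inv_mem h'.2)]
  simp only [hterm, Finset.sum_const, Finset.card_univ] at hsum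
  rw [hμν]
  exact hH' _ hsum

/-- `Σ_{h′ ∈ H′} ν(ρ(h′)⁻¹ ρ(k) a) = Σ_{h′ ∈ H′} ν(ρ(h′)⁻¹ a)` for `k ∈ H′` (reindex `h′ ↦ k⁻¹h′`). [folklore] -/
private theorem sum_comp_mem (ρ : G →* AddMonoid.End A) (ν : A →+ R) {k : G} (hk : k ∈ H') (a : A) :
    ∑ h' : H', ν (ρ (h' : G)⁻¹ (ρ k a)) = ∑ h' : H', ν (ρ (h' : G)⁻¹ a) := by
  have key : ∀ h' : H', ν (ρ (h' : G)⁻¹ (ρ k a)) = ν (ρ (((⟨k⁻¹, H'.inv_mem hk⟩ : H') * h' : H') : G)⁻¹ a) :=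
    fun h' => by
      have hcoe : (((⟨k⁻¹, H'.inv_mem hk⟩ : H') * h' : H') : G) = k⁻¹ * (h' : G) := rfl
      rw [hcoe, mul_inv_rev, inv_inv, rho_mul_apply]
  simp_rw [key]
  exact Fintype.sum_equiv (Equiv.mulLeft (⟨k⁻¹, H'.inv_mem hk⟩ : H')) _ _ fun _ => rfl

/-- The `H′`-average `ν′(a) = u • Σ_{h′ ∈ H′} ν(ρ(h′)⁻¹ a)` is `H′`-invariant. [folklore] -/
private theorem average_invariant (ρ : G →* AddMonoid.End A) (u : ℤ) (ν : A →+ R) {k : G} (hk : k ∈ H') (a : A) :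
    u • ∑ h' : H', ν (ρ (h' : G)⁻¹ (ρ k a)) = u • ∑ h' : H', ν (ρ (h' : G)⁻¹ a) := by
  rw [sum_comp_mem H' R ρ ν hk]

/-- **If `Hom_G(A, C(G; H ≤ H′)) = 0` then every `H`-invariant character `ν : A → R` is `H′`-invariant** (`H ≤ H′`,
`u • #H′ = 1` on `R`): `μ_ν(a)(g) = ν(ρ(g)⁻¹ a) − ν′(ρ(g)⁻¹ a)` (`ν′(b) = u • Σ_{h′} ν(ρ(h′)⁻¹ b)` the `H′`-average) is
equivariant with values in the coset kernel, so it vanishes; then `ν = ν′`, which is `H′`-invariant (the other half of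
Frobenius reciprocity on the kernel of `Ind_H^G R ↠ Ind_{H′}^G R`). [cite: SerreLinearRepresentations1977, §7.2 Thm. 13 (Frobenius reciprocity)] -/
theorem invariant_of_forall_equivariantHom_eq_zero (ρ : G →* AddMonoid.End A) (hHH' : H ≤ H') (u : ℤ)
    (hu : ∀ r : R, u • (Fintype.card H' • r) = r)
    (hvan : ∀ μ : A →+ cosetKernel H H' R, (∀ (σ : G) (a : A), μ (ρ σ a) = σ • μ a) → μ = 0)
    (ν : A →+ R) (hν : ∀ h ∈ H, ∀ a : A, ν (ρ h a) = ν a) :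
    ∀ h' ∈ H', ∀ a : A, ν (ρ h' a) = ν a := by
  -- the average `ν′`
  let ν' : A → R := fun b => u • ∑ h' : H', ν (ρ (h' : G)⁻¹ b)
  have hν'def : ∀ b, ν' b = u • ∑ h' : H', ν (ρ (h' : G)⁻¹ b) := fun b => rfl
  have hν'inv : ∀ k ∈ H', ∀ b : A, ν' (ρ k b) = ν' b := fun k hk b => by
    rw [hν'def, hν'def, average_invariant H' R ρ u ν hk]
  have hν'add : ∀ b c : A, ν' (b + c) = ν' b + ν' c := fun b c => by
    rw [hν'def, hν'def, hν'def, ← smul_add, ← Finset.sum_add_distrib]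
    congr 1
    exact Finset.sum_congr rfl fun h' _ => by rw [map_add, map_add]
  have hν'zero : ν' 0 = 0 := by
    rw [hν'def]
    have hterm0 : ∀ h' : H', ν (ρ (h' : G)⁻¹ 0) = 0 := fun h' => by rw [map_zero, map_zero]
    simp only [hterm0, Finset.sum_const_zero, smul_zero]
  -- for an `H′`-invariant argument, `Σ_{h′} ν′(ρ h′⁻¹ b) = #H′ • ν′ b` and `Σ_{h′} ν(ρ h′⁻¹ b) = u⁻¹ ν′ b`
  -- the map `μ_ν`
  let μ : A →+ cosetKernel H H' R :=
    { toFun := fun a => ⟨fun g => ν (ρ g⁻¹ a) - ν' (ρ g⁻¹ a), by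
        refine ⟨fun g h hh => ?_, fun g => ?_⟩
        · change ν (ρ (g * h)⁻¹ a) - ν' (ρ (g * h)⁻¹ a) = ν (ρ g⁻¹ a) - ν' (ρ g⁻¹ a)
          rw [mul_inv_rev, rho_mul_apply, hν _ (H.inv_mem hh), hν'inv _ (hHH' (H.inv_mem hh))]
        · change ∑ h' : H', (ν (ρ (g * (h' : G))⁻¹ a) - ν' (ρ (g * (h' : G))⁻¹ a)) = 0
          have hterm : ∀ h' : H', ν (ρ (g * (h' : G))⁻¹ a) - ν' (ρ (g * (h' : G))⁻¹ a) =
              ν (ρ (h' : G)⁻¹ (ρ g⁻¹ a)) - ν' (ρ g⁻¹ a) := fun h' => by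
            rw [mul_inv_rev, rho_mul_apply, hν'inv _ (H'.inv_mem h'.2)]
          simp only [hterm, Finset.sum_sub_distrib, Finset.sum_const, Finset.card_univ]
          rw [hν'def (ρ g⁻¹ a), smul_comm, hu, sub_self]⟩
      map_zero' := Subtype.ext (funext fun g => by
        change ν (ρ g⁻¹ 0) - ν' (ρ g⁻¹ 0) = 0
        rw [map_zero, map_zero, hν'zero, sub_zero])
      map_add' := fun a b => Subtype.ext (funext fun g => by
        change ν (ρ g⁻¹ (a + b)) - ν' (ρ g⁻¹ (a + b)) =
          (ν (ρ g⁻¹ a) - ν' (ρ g⁻¹ a)) + (ν (ρ g⁻¹ b) - ν' (ρ g⁻¹ b))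
        rw [map_add, map_add, hν'add]
        abel) }
  have hμapp : ∀ (a : A) (g : G), (μ a).1 g = ν (ρ g⁻¹ a) - ν' (ρ g⁻¹ a) := fun a g => rfl
  have hμeq : ∀ (σ : G) (a : A), μ (ρ σ a) = σ • μ a := fun σ a =>
    Subtype.ext (funext fun g => by
      rw [hμapp, coe_smul_apply, hμapp, ← rho_mul_apply, mul_inv_rev, inv_inv])
  have h0 := hvan μ hμeq
  have hνν' : ∀ a : A, ν a = ν' a := fun a => by
    have h := congrArg (fun φ : A →+ cosetKernel H H' R => (φ a).1 1) h0
    rw [AddMonoidHom.zero_apply, hμapp, inv_one, rho_one_apply] at h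
    exact sub_eq_zero.mp (h.trans rfl)
  intro h' hh' a
  rw [hνν', hνν' a]
  exact hν'inv h' hh' a

end Characters

end Literature.RepresentationTheory.FiniteGroups

end
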